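import Summits.NavierStokesRegularity.FluidComputer.LipRowTools
import Summits.NavierStokesRegularity.FluidComputer.LipRowContinuity
import HarnessLib

/-!
# Fluid computer — support: the ν-FREE, ENERGY-FREE Riccati law of the `Ḃ^{5/2}_{2,1}` row,
# `P(t) − P(s) ≤ K ∫_s^t P(τ)² dτ`, `P(τ) = ∑_l 2^{5l/2} ‖Δ̇_l u(τ)‖₂`

HONEST FRAMING (cell `pub-fluidc`, verbatim): *low prior, high value-of-information experiment on Tao's
machine paradigm; NOT a claim that NS blows up.* Support file. Along every maximal smooth solution `(u, p)` of the
unforced Navier–Stokes system on `ℝ³ × [0, T)` (`ν > 0`) which is Leray–Hopf from `u 0`: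

* per block (inside the proof): `a_l(t) − a_l(s) ≤ ∫_s^t M_l`, where
  `M_l = A (C'_B (∑_{|m|≤2} a_{l+m}) P + C_B 2^{3l/2} Q_l)` is a CONTINUOUS majorant of `|N_l|/a_l` (the pointwise
  transfer ceiling `RiccatiSlice.exists_enorm_transfer_le_local`, Bernstein `s_l ≤ C_B 2^{3l/2} a_l`, the coarse strain
  `T_{l+m} ≤ R ≤ C'_B P`; continuity from `LipRowContinuity`); the dissipation is dropped and the square root is taken by
  `LipRowTools.sqrt_le_sqrt_add_integral` — no division by `a_l`;
* `lipRow_two_point` (**THE RICCATI LAW OF THE `Ḃ^{5/2}_{2,1}` ROW, integrated**) — one ABSOLUTE `K > 0` with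
  `P(t) − P(s) ≤ K ∫_s^t P(τ)² dτ` for all `0 < s ≤ t < T` (the windows `∑_{|l|≤L}`, `LipRowTools.lipRow_summation`,
  `L → ∞`): the dyadic form of McCormick et al.'s `d/dt ‖u‖_{Ḃ^{5/2}_{2,1}} ≲ ‖u‖²_{Ḃ^{5/2}_{2,1}}` — no `ν`, no energy.

0 sorry; no definitions; no named facts.

## References

* D. S. McCormick, E. J. Olson, J. C. Robinson, J. L. Rodrigo, A. Vidal-López, Y. Zhou, SIAM J. Math. Anal. 48 (2016)
  2119–2132, Thm. 1.1. [MccormickEtAl2016]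
* H. Bahouri, J.-Y. Chemin, R. Danchin, Grundlehren 343 (2011), Lemma 2.1, Lemma 2.100. [BahouriCheminDanchin2011]
-/

noncomputable section

open MeasureTheory Set Function Filter Topology
open scoped ENNReal NNReal RealInnerProductSpace
open Literature.Analysis.FluidPDE Literature.Analysis.FunctionSpaces
open Summit.NavierStokesRegularity.FluidComputer.BlockEnergyTransport
open Summit.NavierStokesRegularity.FluidComputer.BlockEnergyIdentity
open Summit.NavierStokesRegularity.FluidComputer.BlockEnergyContinuity
open Summit.NavierStokesRegularity.FluidComputer.BlockAmplitudeCeiling (exists_blockSup_le_blockL2)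
open Summit.NavierStokesRegularity.FluidComputer.LipschitzSummation (paraT_le_row)
open Summit.NavierStokesRegularity.FluidComputer.EulerRateInequality (lipschitzRow_le_lipRow)
open Summit.NavierStokesRegularity.FluidComputer.LipRowTools
open Summit.NavierStokesRegularity.FluidComputer.LipRowContinuity

namespace Summit.NavierStokesRegularity.FluidComputer.LipRowInequality

/-! ## The integrated Riccati law of the `Ḃ^{5/2}_{2,1}` row -/

/-- **THE ν-FREE, ENERGY-FREE RICCATI LAW OF THE `Ḃ^{5/2}_{2,1}` ROW (integrated).** There is an ABSOLUTE `K > 0` such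
that for every `ν > 0`, `T > 0`, every maximal smooth solution `(u, p)` of the unforced Navier–Stokes system on
`ℝ³ × [0, T)` which is Leray–Hopf from `u 0`, and all `0 < s ≤ t < T`:
`P(t) − P(s) ≤ K ∫_s^t P(τ)² dτ`, `P(τ) = ∑_{l∈ℤ} 2^{5l/2} ‖Δ̇_l u(τ)‖₂` (real values). Per block,
`a_l(t) − a_l(s) ≤ ∫_s^t M_l` with the continuous majorant `M_l = A(C'_B(∑_{|m|≤2}a_{l+m})P + C_B2^{3l/2}Q_l)` of
`|N_l|/a_l` (block balance with the dissipation dropped + `sqrt_le_sqrt_add_integral`); then `∑_{|l|≤L} 2^{5l/2}M_l ≤ K P²`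
(`lipRow_summation`) and `L → ∞`. [cite: MccormickEtAl2016, Thm. 1.1] [cite: BahouriCheminDanchin2011, Lemma 2.100] -/
theorem lipRow_two_point :
    ∃ K : ℝ, 0 < K ∧ ∀ (ν T : ℝ), 0 < ν → 0 < T →
      ∀ (u : ℝ → EuclideanSpace ℝ (Fin 3) → EuclideanSpace ℝ (Fin 3)) (p : ℝ → EuclideanSpace ℝ (Fin 3) → ℝ),
      IsMaximalSmoothSolution ν 0 u p T → IsLerayHopfOn T ν 0 (u 0) u →
      ∀ s t : ℝ, 0 < s → s ≤ t → t < T →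
        (∑' l : ℤ, (2 : ℝ≥0∞) ^ ((5 / 2 : ℝ) * (l : ℝ)) * blockL2 (u t) l).toReal -
            (∑' l : ℤ, (2 : ℝ≥0∞) ^ ((5 / 2 : ℝ) * (l : ℝ)) * blockL2 (u s) l).toReal ≤
          K * ∫ τ in s..t, ((∑' l : ℤ, (2 : ℝ≥0∞) ^ ((5 / 2 : ℝ) * (l : ℝ)) * blockL2 (u τ) l).toReal) ^ 2 := by
  obtain ⟨A, hAtop, hA⟩ := RiccatiSlice.exists_enorm_transfer_le_local
  obtain ⟨CB, -, hCB⟩ := exists_blockSup_le_blockL2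
  obtain ⟨CB', hCB'⟩ := lipschitzRow_le_lipRow
  -- the absolute constant
  set Ke : ℝ≥0∞ := A * ((CB' : ℝ≥0∞) + CB) * (5 * (2 : ℝ≥0∞) ^ (5 : ℝ) + 5 * (2 : ℝ≥0∞) ^ (20 : ℝ)) with hKe
  have hKetop : Ke ≠ ∞ := ENNReal.mul_ne_top (ENNReal.mul_ne_top hAtop (ENNReal.add_ne_top.2
    ⟨ENNReal.coe_ne_top, ENNReal.coe_ne_top⟩)) (ENNReal.add_ne_top.2
    ⟨ENNReal.mul_ne_top (by norm_num) (RiccatiSlice.two_rpow_ne_top _),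
      ENNReal.mul_ne_top (by norm_num) (RiccatiSlice.two_rpow_ne_top _)⟩)
  refine ⟨Ke.toReal + 1, by positivity, fun ν T hν hT u p hmax hLH s t hs hst htT => ?_⟩
  -- abbreviations
  set w : ℤ → ℝ≥0∞ := fun l => (2 : ℝ≥0∞) ^ ((5 / 2 : ℝ) * (l : ℝ)) with hw
  set a : ℝ → ℤ → ℝ≥0∞ := fun τ l => blockL2 (u τ) l with ha
  set Pe : ℝ → ℝ≥0∞ := fun τ => ∑' l : ℤ, w l * a τ l with hPe
  set P : ℝ → ℝ := fun τ => (Pe τ).toReal with hP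
  set Qe : ℤ → ℝ → ℝ≥0∞ := fun l τ => paraQ2 (a τ) (fun k => (2 : ℝ≥0∞) ^ k * a τ k) l with hQe
  -- the ENNReal majorant `Me_l` and its real version `M_l`
  set Me : ℤ → ℝ → ℝ≥0∞ := fun l τ =>
    A * ((CB' : ℝ≥0∞) * (∑ m ∈ Finset.Icc (-2 : ℤ) 2, a τ (l + m)) * Pe τ +
      (CB : ℝ≥0∞) * (2 : ℝ≥0∞) ^ ((3 / 2 : ℝ) * (l : ℝ)) * Qe l τ) with hMe
  set M : ℤ → ℝ → ℝ := fun l τ => (Me l τ).toReal with hM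
  have hsub : Icc s t ⊆ Ioo 0 T := fun τ hτ => ⟨hs.trans_le hτ.1, hτ.2.trans_lt htT⟩
  have hsm : ∀ τ ∈ Icc s t, IsSmoothL2Field (u τ) := fun τ hτ =>
    isSmoothL2Field_slice_of_maximal hν hT hmax hLH (hsub hτ)
  have hdiv : ∀ τ ∈ Icc s t, VectorCalculus.IsDivFree (u τ) := fun τ hτ =>
    hmax.1.divFree τ ⟨(hsub hτ).1.le, (hsub hτ).2⟩
  have hatop : ∀ τ ∈ Icc s t, ∀ l, a τ l ≠ ∞ := fun τ hτ l =>
    (((hsm τ hτ).blockFn l).memLp_two).eLpNorm_ne_top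
  obtain ⟨B, hB0, hB⟩ := exists_lipRow_envelope hν hT hmax hLH hs hst htT
  have hPetop : ∀ τ ∈ Icc s t, Pe τ ≠ ∞ := fun τ hτ => (hB τ hτ).2.1
  have hQtop : ∀ l, ∀ τ ∈ Icc s t, Qe l τ ≠ ∞ := fun l τ hτ =>
    (continuousOn_paraQ2 hν hT hmax hLH hs hst htT l).1 τ hτ
  have hMetop : ∀ l, ∀ τ ∈ Icc s t, Me l τ ≠ ∞ := by
    intro l τ hτ
    refine ENNReal.mul_ne_top hAtop (ENNReal.add_ne_top.2 ⟨?_, ?_⟩)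
    · exact ENNReal.mul_ne_top (ENNReal.mul_ne_top ENNReal.coe_ne_top
        (ENNReal.sum_ne_top.2 fun m _ => hatop τ hτ _)) (hPetop τ hτ)
    · exact ENNReal.mul_ne_top (ENNReal.mul_ne_top ENNReal.coe_ne_top (RiccatiSlice.two_rpow_ne_top _)) (hQtop l τ hτ)
  -- continuity of the pieces
  have hPc : ContinuousOn P (Icc s t) := continuousOn_lipRow hν hT hmax hLH hs hst htT
  have hac : ∀ l, ContinuousOn (fun τ => (a τ l).toReal) (Icc s t) := by
    intro l
    have h := continuousOn_weight52_blockL2 hν hT hmax hLH hs htT 1 l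
    simpa only [one_mul] using h
  have hQc : ∀ l, ContinuousOn (fun τ => (Qe l τ).toReal) (Icc s t) := fun l =>
    (continuousOn_paraQ2 hν hT hmax hLH hs hst htT l).2
  have hMc : ∀ l, ContinuousOn (M l) (Icc s t) := by
    intro l
    have heq : ∀ τ ∈ Icc s t, M l τ = A.toReal * ((CB' : ℝ) * (∑ m ∈ Finset.Icc (-2 : ℤ) 2, (a τ (l + m)).toReal) * P τ +
        (CB : ℝ) * ((2 : ℝ≥0∞) ^ ((3 / 2 : ℝ) * (l : ℝ))).toReal * (Qe l τ).toReal) := by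
      intro τ hτ
      simp only [hM, hMe, hP]
      rw [ENNReal.toReal_mul, ENNReal.toReal_add, ENNReal.toReal_mul, ENNReal.toReal_mul, ENNReal.toReal_mul,
        ENNReal.toReal_mul, ENNReal.coe_toReal, ENNReal.coe_toReal,
        ENNReal.toReal_sum fun m _ => hatop τ hτ _]
      · exact ENNReal.mul_ne_top (ENNReal.mul_ne_top ENNReal.coe_ne_top
          (ENNReal.sum_ne_top.2 fun m _ => hatop τ hτ _)) (hPetop τ hτ)
      · exact ENNReal.mul_ne_top (ENNReal.mul_ne_top ENNReal.coe_ne_top (RiccatiSlice.two_rpow_ne_top _)) (hQtop l τ hτ)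
    refine ContinuousOn.congr ?_ heq
    refine continuousOn_const.mul ((((continuousOn_const.mul (continuousOn_finsetSum _ fun m _ => hac (l + m))).mul
      hPc)).add ((continuousOn_const.mul continuousOn_const).mul (hQc l)))
  have hM0 : ∀ l τ, 0 ≤ M l τ := fun l τ => ENNReal.toReal_nonneg
  -- Step 1: the pointwise transfer ceiling `|N_l| ≤ a_l · M_l`
  have hN : ∀ τ ∈ Icc s t, ∀ l,
      |∫ x, ⟪blockFn l (u τ) x, blockFn l (convect (u τ) (u τ)) x⟫| ≤ (a τ l).toReal * M l τ := by
    intro τ hτ l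
    have hw2 : MemLp (u τ) 2 volume := (hsm τ hτ).memLp_two
    have h1 := hA (u τ) (hsm τ hτ) (hdiv τ hτ) l
    -- bound the low-mode shapes by `a_l · Me_l`
    have hR : ∑' k : ℤ, (2 : ℝ≥0∞) ^ k * blockSup (u τ) k ≤ (CB' : ℝ≥0∞) * Pe τ := hCB' (u τ) hw2
    have hT : ∀ m, paraT (fun k => (2 : ℝ≥0∞) ^ k * blockSup (u τ) k) (l + m) ≤ (CB' : ℝ≥0∞) * Pe τ := fun m =>
      (paraT_le_row (blockSup (u τ)) (l + m)).trans hR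
    have hs_l : blockSup (u τ) l ≤ CB * (2 : ℝ≥0∞) ^ ((3 / 2 : ℝ) * (l : ℝ)) * a τ l := by
      have h := hCB (u τ) hw2 l
      rwa [show (3 : ℝ) * (l : ℝ) / 2 = (3 / 2 : ℝ) * (l : ℝ) by ring] at h
    have h2 : A * (blockL2 (u τ) l * ∑ m ∈ Finset.Icc (-2 : ℤ) 2, blockL2 (u τ) (l + m) *
          paraT (fun k => (2 : ℝ≥0∞) ^ k * blockSup (u τ) k) (l + m) +
        blockSup (u τ) l * paraQ2 (blockL2 (u τ)) (fun k => (2 : ℝ≥0∞) ^ k * blockL2 (u τ) k) l) ≤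
        a τ l * Me l τ := by
      have hsum : ∑ m ∈ Finset.Icc (-2 : ℤ) 2, blockL2 (u τ) (l + m) *
          paraT (fun k => (2 : ℝ≥0∞) ^ k * blockSup (u τ) k) (l + m) ≤
          (∑ m ∈ Finset.Icc (-2 : ℤ) 2, a τ (l + m)) * ((CB' : ℝ≥0∞) * Pe τ) := by
        rw [Finset.sum_mul]
        exact Finset.sum_le_sum fun m _ => mul_le_mul' le_rfl (hT m)
      calc _ ≤ A * (a τ l * ((∑ m ∈ Finset.Icc (-2 : ℤ) 2, a τ (l + m)) * ((CB' : ℝ≥0∞) * Pe τ)) +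
            (CB * (2 : ℝ≥0∞) ^ ((3 / 2 : ℝ) * (l : ℝ)) * a τ l) * Qe l τ) := by
            gcongr
        _ = a τ l * Me l τ := by simp only [hMe]; ring
    have h3 : ‖∫ x, ⟪blockFn l (u τ) x, blockFn l (convect (u τ) (u τ)) x⟫‖ₑ ≤ a τ l * Me l τ := h1.trans h2
    have h4 := ENNReal.toReal_mono (ENNReal.mul_ne_top (hatop τ hτ l) (hMetop l τ hτ)) h3
    rwa [Real.enorm_eq_ofReal_abs, ENNReal.toReal_ofReal (abs_nonneg _), ENNReal.toReal_mul] at h4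
  -- Step 2: per block, `a_l(t) − a_l(s) ≤ ∫ M_l` by the square-root comparison
  have hblock : ∀ l, (a t l).toReal - (a s l).toReal ≤ ∫ τ in s..t, M l τ := by
    intro l
    set e : ℝ → ℝ := fun τ => (a τ l ^ 2).toReal with he
    have hea : ∀ τ, Real.sqrt (e τ) = (a τ l).toReal := fun τ => by
      simp only [he]; rw [ENNReal.toReal_pow, Real.sqrt_sq ENNReal.toReal_nonneg]
    have hec : ContinuousOn e (Icc s t) :=
      ENNReal.continuousOn_toReal.comp ((continuousOn_blockL2_sq hν hT hmax hLH l).mono hsub)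
        fun τ hτ => ENNReal.pow_ne_top (hatop τ hτ l)
    have hineq : ∀ τ ∈ Icc s t, e τ - e s ≤ 2 * ∫ r in s..τ, Real.sqrt (e r) * M l r := by
      intro τ hτ
      rcases hτ.1.eq_or_lt with h0 | hsτ
      · subst h0; simp
      have hτT : τ < T := hτ.2.trans_lt htT
      obtain ⟨hNint, hSint, hid⟩ := blockL2_sq_toReal_sub_eq hν hT hmax hLH hs hsτ.le hτT l
      simp only [he]
      rw [hid]
      refine mul_le_mul_of_nonneg_left ?_ (by norm_num)
      have hint2 : IntervalIntegrable (fun r => Real.sqrt (e r) * M l r) volume s τ :=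
        (((Real.continuous_sqrt.comp_continuousOn hec).mul (hMc l)).mono
          (Icc_subset_Icc le_rfl hτ.2)).intervalIntegrable_of_Icc hsτ.le
      refine intervalIntegral.integral_mono_on hsτ.le ((hSint.const_mul (-ν)).sub hNint) hint2 fun r hr => ?_
      have hrI : r ∈ Icc s t := ⟨hr.1, hr.2.trans hτ.2⟩
      have hS0 : 0 ≤ ∑ i, ∫ x, ‖fderiv ℝ (blockFn l (u r)) x
          (stdOrthonormalBasis ℝ (EuclideanSpace ℝ (Fin 3)) i)‖ ^ 2 :=
        Finset.sum_nonneg fun i _ => integral_nonneg fun x => sq_nonneg _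
      have hNr := hN r hrI l
      rw [hea]
      have habs := neg_le_abs (∫ x, ⟪blockFn l (u r) x, blockFn l (convect (u r) (u r)) x⟫)
      nlinarith [mul_nonneg hν.le hS0]
    have h := sqrt_le_sqrt_add_integral hst hec (hMc l) (fun τ _ => ENNReal.toReal_nonneg) (fun τ _ => hM0 l τ) hineq
    rw [hea, hea] at h
    linarith
  -- Step 3: the weighted windows
  have hwtop : ∀ l, w l ≠ ∞ := fun l => RiccatiSlice.two_rpow_ne_top _
  have hL : ∀ L : ℕ, (∑ l ∈ Finset.Icc (-(L : ℤ)) L, (w l * a t l).toReal) -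
      (∑ l ∈ Finset.Icc (-(L : ℤ)) L, (w l * a s l).toReal) ≤ (Ke.toReal + 1) * ∫ τ in s..t, P τ ^ 2 := by
    intro L
    set I : Finset ℤ := Finset.Icc (-(L : ℤ)) L with hI
    -- each weighted block
    have h1 : (∑ l ∈ I, (w l * a t l).toReal) - (∑ l ∈ I, (w l * a s l).toReal) ≤
        ∑ l ∈ I, (w l).toReal * ∫ τ in s..t, M l τ := by
      rw [← Finset.sum_sub_distrib]
      refine Finset.sum_le_sum fun l _ => ?_
      rw [ENNReal.toReal_mul, ENNReal.toReal_mul, ← mul_sub]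
      exact mul_le_mul_of_nonneg_left (hblock l) ENNReal.toReal_nonneg
    have hMint : ∀ l, IntervalIntegrable (M l) volume s t := fun l => (hMc l).intervalIntegrable_of_Icc hst
    have h2 : ∑ l ∈ I, (w l).toReal * ∫ τ in s..t, M l τ = ∫ τ in s..t, ∑ l ∈ I, (w l).toReal * M l τ := by
      rw [intervalIntegral.integral_finsetSum fun l _ => (hMint l).const_mul _]
      refine Finset.sum_congr rfl fun l _ => ?_
      rw [intervalIntegral.integral_const_mul]
    -- the pointwise summation bound
    have h3 : ∀ τ ∈ Icc s t, ∑ l ∈ I, (w l).toReal * M l τ ≤ (Ke.toReal + 1) * P τ ^ 2 := by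
      intro τ hτ
      have hsumE : ∑ l ∈ I, w l * Me l τ ≤ Ke * Pe τ ^ 2 := by
        have hmax : ∀ l, Me l τ ≤ A * (((CB' : ℝ≥0∞) + CB) *
            ((∑ m ∈ Finset.Icc (-2 : ℤ) 2, a τ (l + m)) * Pe τ + (2 : ℝ≥0∞) ^ ((3 / 2 : ℝ) * (l : ℝ)) * Qe l τ)) := by
          intro l
          simp only [hMe]
          refine mul_le_mul' le_rfl ?_
          rw [mul_add]
          refine add_le_add ?_ ?_
          · rw [mul_assoc]; exact mul_le_mul' le_self_add le_rfl
          · rw [mul_assoc]; exact mul_le_mul' le_add_self le_rfl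
        calc ∑ l ∈ I, w l * Me l τ
            ≤ ∑ l ∈ I, w l * (A * (((CB' : ℝ≥0∞) + CB) *
                ((∑ m ∈ Finset.Icc (-2 : ℤ) 2, a τ (l + m)) * Pe τ + (2 : ℝ≥0∞) ^ ((3 / 2 : ℝ) * (l : ℝ)) * Qe l τ))) :=
              Finset.sum_le_sum fun l _ => mul_le_mul' le_rfl (hmax l)
          _ ≤ ∑' l : ℤ, w l * (A * (((CB' : ℝ≥0∞) + CB) *
                ((∑ m ∈ Finset.Icc (-2 : ℤ) 2, a τ (l + m)) * Pe τ + (2 : ℝ≥0∞) ^ ((3 / 2 : ℝ) * (l : ℝ)) * Qe l τ))) :=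
              ENNReal.sum_le_tsum I
          _ = A * ((CB' : ℝ≥0∞) + CB) * ∑' l : ℤ, w l *
                ((∑ m ∈ Finset.Icc (-2 : ℤ) 2, a τ (l + m)) * Pe τ + (2 : ℝ≥0∞) ^ ((3 / 2 : ℝ) * (l : ℝ)) * Qe l τ) := by
              rw [← ENNReal.tsum_mul_left]
              exact tsum_congr fun l => by ring
          _ ≤ A * ((CB' : ℝ≥0∞) + CB) * ((5 * (2 : ℝ≥0∞) ^ (5 : ℝ) + 5 * (2 : ℝ≥0∞) ^ (20 : ℝ)) * Pe τ ^ 2) :=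
              mul_le_mul' le_rfl (lipRow_summation (a τ))
          _ = Ke * Pe τ ^ 2 := by simp only [hKe]; ring
      have hfin : ∀ l ∈ I, w l * Me l τ ≠ ∞ := fun l _ => ENNReal.mul_ne_top (hwtop l) (hMetop l τ hτ)
      have h4 := ENNReal.toReal_mono (ENNReal.mul_ne_top hKetop (ENNReal.pow_ne_top (hPetop τ hτ))) hsumE
      rw [ENNReal.toReal_sum hfin, ENNReal.toReal_mul, ENNReal.toReal_pow] at h4
      have h5 : ∑ l ∈ I, (w l).toReal * M l τ = ∑ l ∈ I, (w l * Me l τ).toReal :=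
        Finset.sum_congr rfl fun l _ => by rw [ENNReal.toReal_mul]
      rw [h5]
      refine h4.trans ?_
      have : 0 ≤ P τ ^ 2 := sq_nonneg _
      simp only [hP]
      nlinarith
    have hint1 : IntervalIntegrable (fun τ => ∑ l ∈ I, (w l).toReal * M l τ) volume s t :=
      (continuousOn_finsetSum I fun l _ => continuousOn_const.mul (hMc l)).intervalIntegrable_of_Icc hst
    have hint2 : IntervalIntegrable (fun τ => (Ke.toReal + 1) * P τ ^ 2) volume s t :=
      ((hPc.pow 2).intervalIntegrable_of_Icc hst).const_mul _
    have hmono := intervalIntegral.integral_mono_on hst hint1 hint2 h3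
    rw [intervalIntegral.integral_const_mul] at hmono
    linarith [h1, h2.le, h2.ge]
  -- Step 4: `L → ∞`
  have hlimF : ∀ τ ∈ Icc s t, Tendsto (fun L : ℕ => ∑ l ∈ Finset.Icc (-(L : ℤ)) L, (w l * a τ l).toReal) atTop
      (𝓝 (P τ)) := by
    intro τ hτ
    have h1 : ∀ L : ℕ, ∑ l ∈ Finset.Icc (-(L : ℤ)) L, (w l * a τ l).toReal =
        (∑ l ∈ Finset.Icc (-(L : ℤ)) L, w l * a τ l).toReal := fun L =>
      (ENNReal.toReal_sum fun l _ => ENNReal.mul_ne_top (hwtop l) (hatop τ hτ l)).symm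
    simp_rw [h1]
    exact (ENNReal.tendsto_toReal (hPetop τ hτ)).comp (tendsto_sum_Icc_atTop _)
  exact le_of_tendsto_of_tendsto ((hlimF t ⟨hst, le_rfl⟩).sub (hlimF s ⟨le_rfl, hst⟩)) tendsto_const_nhds
    (Eventually.of_forall hL)

end Summit.NavierStokesRegularity.FluidComputer.LipRowInequality

end
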